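import Summits.AnomalousDissipation.AnomalousDissipation.Theses.DopplerClock
import Summits.AnomalousDissipation.AnomalousDissipation.Theorems.ImpulseGridMeanMomentumBalance
import Literature.Analysis.FluidPDE.DoeringFoiasPowerProofs
import Literature.Analysis.FluidPDE.LerayHopfMomentum

/-!
# Route DopplerClock (AnomalousDissipation) — crux `QuadratureStressFloor` (stmt-AnomalousDissipation-18129),
# line `laminar-burst-shadowing` (payload slug `Sketch`): the ENERGY-FREE CLOCK-TERM BOUND

The crux C1 carries only PER-`j` sup-in-time energy bounds ("energy NOT assumed"), whereas every bridge landed so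
far (`stub_bridgePeriodicWitnesses`, `stub_bridgeNoLeakInjectionFloor`) consumes a ν-UNIFORM energy cap, used at
exactly one place: to bound the clock term `ν_j κ² Λ⟨(Ψ_s, u_j)⟩` of the two-mode identity
`−Λ⟨T_s(w_j)⟩ = (2πnV/F) Λ⟨(f,u_j)⟩ − ν_j κ² Λ⟨(Ψ_s,u_j)⟩` (`dopplerWorkIdentity_proof`, item 18133).
This file proves the bound that needs NO energy hypothesis (registered stub `stub_clockTermBound`):

for a global Leray–Hopf solution of `NS_ν` on `T³` (`ν > 0`) under a steady smooth mean-zero force `f`, with a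
per-solution sup-energy bound (only to make Cesàro means honest), a continuous mean-zero pattern `a` with `‖a‖ ≤ K`,
any generalized limit `Λ` and ANY `δ > 0`:
`|Λ⟨(a,u)⟩| ≤ δ/2 + K² Λ⟨(f,u)⟩ / (8π²νδ)`.

Proof: `(a,u(t)) = (a, u(t) − ū)` (`∫a = 0`); Young `K‖w‖ ≤ δ/2 + K²‖w‖²/(2δ)` pointwise; the integrated Poincaré
inequality at the conserved momentum `4π² ∫₀ᵀ‖u − ū‖₂² ≤ ∫₀ᵀ‖∇u‖₂²`
(`Torus.IsGlobalLerayHopf.intervalIntegral_norm_sq_le_dissipation`); the Leray–Hopf energy inequality from `0`,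
`ν∫₀ᵀ‖∇u‖₂² ≤ ½‖u₀‖₂² + ∫₀ᵀ(f,u)`; divide by `T` and apply `Λ` (monotone on eventually bounded functions; kills
`½‖u₀‖₂²/T`). Large energy is paid for by injection, so the sup-energy constant never enters. Optimising `δ` gives
`ν|Λ⟨(a,u)⟩| ≤ K √(ν Λ⟨(f,u)⟩)/(2π)` (not needed downstream).

No new definitions (Doering–Foias 2002 §2; Foias–Manley–Rosa–Temam 2001 Ch. IV §1.3, §3.1).
-/

noncomputable section

-- `Summit.<Summit>.<Problem>` is the tree's mandated summit-side namespace (CONVENTIONS §2); for this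
-- single-conjunct summit the two coincide, so the duplicate is deliberate.
set_option linter.dupNamespace false

open MeasureTheory Set Filter Topology
open scoped InnerProductSpace RealInnerProductSpace

namespace Summit.AnomalousDissipation.AnomalousDissipation.Theorems

open Literature.Analysis.FunctionSpaces Literature.Analysis.FunctionSpaces.Torus
open Literature.Analysis.FluidPDE Literature.Analysis.FluidPDE.Torus

namespace EnergyFreeBridge

variable {ν : ℝ} {f a u₀ : UnitAddTorus (Fin 3) → EuclideanSpace ℝ (Fin 3)}
  {u : ℝ → UnitAddTorus (Fin 3) → EuclideanSpace ℝ (Fin 3)}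

/-- **Young's inequality for a bounded pattern against an `L²` field** on the unit torus (volume one):
if `‖a‖ ≤ K` pointwise then `∫⟪a, w⟫ ≤ δ/2 + K²/(2δ) · ∫‖w‖²` for every `δ > 0`
(`⟪a,w⟫ ≤ K‖w‖ ≤ δ/2 + K²‖w‖²/(2δ)` pointwise). [folklore] -/
theorem integral_inner_le_young {w : UnitAddTorus (Fin 3) → EuclideanSpace ℝ (Fin 3)}
    (ha : Continuous a) {K : ℝ} (hK : ∀ x, ‖a x‖ ≤ K) (hw : MemLp w 2 volume) {δ : ℝ} (hδ : 0 < δ) :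
    ∫ x, ⟪a x, w x⟫ ≤ δ / 2 + K ^ 2 / (2 * δ) * ∫ x, ‖w x‖ ^ 2 := by
  have hK0 : 0 ≤ K := (norm_nonneg _).trans (hK 0)
  have haL2 : MemLp a 2 volume := MemLp.of_bound ha.aestronglyMeasurable K (ae_of_all _ hK)
  have hpt : ∀ x, ⟪a x, w x⟫ ≤ δ / 2 + K ^ 2 / (2 * δ) * ‖w x‖ ^ 2 := by
    intro x
    have h1 : ⟪a x, w x⟫ ≤ ‖a x‖ * ‖w x‖ := real_inner_le_norm _ _
    have h2 : ‖a x‖ * ‖w x‖ ≤ K * ‖w x‖ := mul_le_mul_of_nonneg_right (hK x) (norm_nonneg _)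
    have h3 : K * ‖w x‖ ≤ δ / 2 + K ^ 2 / (2 * δ) * ‖w x‖ ^ 2 := by
      have hsq : 0 ≤ (δ - K * ‖w x‖) ^ 2 := sq_nonneg _
      have hid : δ / 2 + K ^ 2 / (2 * δ) * ‖w x‖ ^ 2 - K * ‖w x‖ = (δ - K * ‖w x‖) ^ 2 / (2 * δ) := by
        field_simp
        ring
      have hnn : 0 ≤ (δ - K * ‖w x‖) ^ 2 / (2 * δ) := div_nonneg hsq (by positivity)
      linarith
    linarith
  have hi1 : Integrable (fun x => ⟪a x, w x⟫) volume := integrable_inner_of_memLp_two haL2 hw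
  have hi2 : Integrable (fun x => δ / 2 + K ^ 2 / (2 * δ) * ‖w x‖ ^ 2) volume :=
    (integrable_const _).add ((hw.integrable_norm_pow two_ne_zero).const_mul _)
  calc ∫ x, ⟪a x, w x⟫ ≤ ∫ x, (δ / 2 + K ^ 2 / (2 * δ) * ‖w x‖ ^ 2) := integral_mono hi1 hi2 hpt
    _ = δ / 2 + K ^ 2 / (2 * δ) * ∫ x, ‖w x‖ ^ 2 := by
      rw [integral_add (integrable_const _) ((hw.integrable_norm_pow two_ne_zero).const_mul _),
        integral_const, integral_const_mul]
      simp

/-- **Slice bound.** Along a global Leray–Hopf solution under a steady smooth mean-zero force, for a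
continuous mean-zero pattern `a` with `‖a‖ ≤ K`, every `t > 0` and `δ > 0`:
`∫⟪a, u(t)⟫ ≤ δ/2 + K²/(2δ) · (‖u(t)‖₂² − ‖ū‖²)`, `ū = ∫ u(1)` the conserved momentum
(`(a, u(t)) = (a, u(t) − ū)` since `∫ a = 0`; Young; `‖u(t) − ū‖₂² = ‖u(t)‖₂² − ‖ū‖²`). [folklore] -/
theorem integral_inner_slice_le (hf : IsSmooth f) (hf0 : HasZeroMean f)
    (hu : IsGlobalLerayHopf ν (fun _ => f) u₀ u) (ha : Continuous a) (ha0 : HasZeroMean a)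
    {K : ℝ} (hK : ∀ x, ‖a x‖ ≤ K) {δ : ℝ} (hδ : 0 < δ) {t : ℝ} (ht : 0 < t) :
    ∫ x, ⟪a x, u t x⟫ ≤ δ / 2 + K ^ 2 / (2 * δ) * ((∫ x, ‖u t x‖ ^ 2) - ‖∫ x, u 1 x‖ ^ 2) := by
  have haL2 : MemLp a 2 volume := MemLp.of_bound ha.aestronglyMeasurable K (ae_of_all _ hK)
  have hut : MemLp (u t) 2 volume := hu.memLp_two ht.le
  have hw : MemLp (fun x => u t x - ∫ y, u t y) 2 volume := hut.sub (memLp_const _)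
  rw [integral_inner_eq_integral_inner_sub_const haL2 ha0 hut (∫ y, u t y)]
  refine (integral_inner_le_young ha hK hw hδ).trans_eq ?_
  rw [integral_norm_sub_integral_sq hut, hu.integral_eq_integral hf hf0 one_pos ht]

/-- **Finite-time clock bound.** Along a global Leray–Hopf solution of `NS_ν` (`ν > 0`) under a steady
smooth mean-zero force `f`, for a continuous mean-zero pattern `a` with `‖a‖ ≤ K`, every `T > 0` and
`δ > 0`:
`T⁻¹∫₀ᵀ (a, u) ≤ δ/2 + K²/(8π²νδ) · (½‖u₀‖₂² T⁻¹ + T⁻¹∫₀ᵀ (f, u))`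
— the slice bound integrated, the integrated Poincaré inequality at the conserved momentum
`4π²∫₀ᵀ ‖u − ū‖₂² ≤ ∫₀ᵀ ‖∇u‖₂²` and the energy inequality from `0`,
`ν ∫₀ᵀ ‖∇u‖₂² ≤ ½‖u₀‖₂² + ∫₀ᵀ (f,u)` (Doering–Foias 2002, §2). [folklore] -/
theorem timeMean_inner_le (hν : 0 < ν) (hf : IsSmooth f) (hf0 : HasZeroMean f)
    (hu : IsGlobalLerayHopf ν (fun _ => f) u₀ u) (ha : Continuous a) (ha0 : HasZeroMean a)
    {K : ℝ} (hK : ∀ x, ‖a x‖ ≤ K) {δ : ℝ} (hδ : 0 < δ) {T : ℝ} (hT : 0 < T) :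
    timeMean (fun t => ∫ x, ⟪a x, u t x⟫) T ≤
      δ / 2 + K ^ 2 / (8 * Real.pi ^ 2 * ν * δ) *
        (kineticEnergy u₀ * T⁻¹ + timeMean (fun t => ∫ x, ⟪f x, u t x⟫) T) := by
  set B : ℝ → ℝ := fun t => ∫ x, ⟪a x, u t x⟫ with hBdef
  set E : ℝ → ℝ := fun t => ∫ x, ‖u t x‖ ^ 2 with hEdef
  set P : ℝ → ℝ := fun t => ∫ x, ⟪f x, u t x⟫ with hPdef
  set M : ℝ := ‖∫ x, u 1 x‖ ^ 2 with hMdef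
  set c : ℝ := K ^ 2 / (2 * δ) with hcdef
  set D : ℝ := (∫⁻ τ in Ioo 0 T, eGradNormSq (u τ)).toReal with hDdef
  have hc0 : 0 ≤ c := by rw [hcdef]; positivity
  -- integrability in time on `(0, T]`
  have hBint : IntegrableOn B (Ioc 0 T) := by
    have h1 : IntegrableOn (fun s => ∫ x, ⟪u s x, a x⟫) (Ioo 0 T) :=
      (hu T hT).integrableOn_integral_inner ha
    have h2 : B = fun s => ∫ x, ⟪u s x, a x⟫ := by
      funext s
      exact integral_congr_ae (ae_of_all _ fun x => real_inner_comm _ _)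
    rw [h2]
    exact (integrableOn_Ioc_iff_integrableOn_Ioo).mpr h1
  have hEint : IntegrableOn E (Ioc 0 T) := hu.integrableOn_integral_norm_sq hT
  have hRint : IntegrableOn (fun t => δ / 2 + c * (E t - M)) (Ioc 0 T) :=
    (integrableOn_const (measure_Ioc_lt_top.ne)).add ((hEint.sub (integrableOn_const
      (measure_Ioc_lt_top.ne))).const_mul c)
  -- integrate the slice bound over `(0, T]`
  have hstep1 : ∫ t in (0 : ℝ)..T, B t ≤ δ / 2 * T + c * ((∫ t in (0 : ℝ)..T, E t) - M * T) := by
    have hle : ∫ t in Ioc 0 T, B t ≤ ∫ t in Ioc 0 T, (δ / 2 + c * (E t - M)) :=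
      setIntegral_mono_on hBint hRint measurableSet_Ioc fun t ht =>
        integral_inner_slice_le hf hf0 hu ha ha0 hK hδ ht.1
    have hcomp : ∫ t in Ioc 0 T, (δ / 2 + c * (E t - M)) =
        δ / 2 * T + c * ((∫ t in Ioc 0 T, E t) - M * T) := by
      have i1 : IntegrableOn (fun _ : ℝ => δ / 2) (Ioc 0 T) := integrableOn_const (measure_Ioc_lt_top.ne)
      have i2 : IntegrableOn (fun t => E t - M) (Ioc 0 T) :=
        hEint.sub (integrableOn_const (measure_Ioc_lt_top.ne))
      rw [integral_add i1 (i2.const_mul c), integral_const_mul,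
        integral_sub hEint (integrableOn_const (measure_Ioc_lt_top.ne)),
        setIntegral_const, setIntegral_const, Real.volume_real_Ioc_of_le hT.le, sub_zero,
        smul_eq_mul, smul_eq_mul]
      ring
    simp only [intervalIntegral.integral_of_le hT.le]
    linarith
  -- Poincaré at the conserved momentum and the energy inequality from `0`
  have hPoinc : 4 * Real.pi ^ 2 * ∫ t in (0 : ℝ)..T, E t ≤ D + 4 * Real.pi ^ 2 * M * T :=
    hu.intervalIntegral_norm_sq_le_dissipation hf hf0 hT
  have hEI : kineticEnergy (u T) + ν * D ≤ kineticEnergy u₀ + ∫ t in (0 : ℝ)..T, P t :=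
    (hu T hT).energy_ineq_zero T ⟨hT.le, le_rfl⟩
  have hKT : 0 ≤ kineticEnergy (u T) := kineticEnergy_nonneg _
  have hpi : 0 < 4 * Real.pi ^ 2 := by positivity
  -- `∫₀ᵀ E − M T ≤ D/(4π²) ≤ (½‖u₀‖² + ∫₀ᵀ P)/(4π²ν)`
  have hstep2 : (∫ t in (0 : ℝ)..T, E t) - M * T ≤
      (kineticEnergy u₀ + ∫ t in (0 : ℝ)..T, P t) / (4 * Real.pi ^ 2 * ν) := by
    rw [le_div_iff₀ (by positivity)]
    have h1 : ν * D ≤ kineticEnergy u₀ + ∫ t in (0 : ℝ)..T, P t := by linarith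
    have h2 : ((∫ t in (0 : ℝ)..T, E t) - M * T) * (4 * Real.pi ^ 2) ≤ D := by nlinarith
    calc ((∫ t in (0 : ℝ)..T, E t) - M * T) * (4 * Real.pi ^ 2 * ν)
        = ((∫ t in (0 : ℝ)..T, E t) - M * T) * (4 * Real.pi ^ 2) * ν := by ring
      _ ≤ D * ν := mul_le_mul_of_nonneg_right h2 hν.le
      _ = ν * D := mul_comm _ _
      _ ≤ _ := h1
  have hstep3 : ∫ t in (0 : ℝ)..T, B t ≤
      δ / 2 * T + c * ((kineticEnergy u₀ + ∫ t in (0 : ℝ)..T, P t) / (4 * Real.pi ^ 2 * ν)) :=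
    hstep1.trans (by nlinarith [mul_le_mul_of_nonneg_left hstep2 hc0])
  -- divide by `T`
  have hTi : 0 < T⁻¹ := inv_pos.2 hT
  unfold timeMean
  have hgoal : T⁻¹ * ∫ t in (0 : ℝ)..T, B t ≤
      T⁻¹ * (δ / 2 * T + c * ((kineticEnergy u₀ + ∫ t in (0 : ℝ)..T, P t) / (4 * Real.pi ^ 2 * ν))) :=
    mul_le_mul_of_nonneg_left hstep3 hTi.le
  refine hgoal.trans_eq ?_
  rw [hcdef]
  field_simp
  ring

/-- **The clock-term bound, one-sided generalized-limit form.** Along a global Leray–Hopf solution of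
`NS_ν` (`ν > 0`) on `T³` under a steady smooth mean-zero force `f`, with `sup_{t ≥ 0} ½‖u(t)‖₂² < ∞`
(only to make the Cesàro means honest), for a continuous mean-zero pattern `a` with `‖a‖ ≤ K`, any
generalized limit `Λ` and any `δ > 0`:
`Λ⟨(a,u)⟩ ≤ δ/2 + K²/(8π²νδ) · Λ⟨(f,u)⟩`
(the finite-time bound, monotonicity of `Λ` on eventually bounded functions, `Λ(½‖u₀‖₂²/T) = 0`;
FMRT 2001, Ch. IV §1.3). The sup-energy constant does NOT enter. [folklore] -/
theorem longTimeAvg_inner_le (Λ : GeneralizedLimit) (hν : 0 < ν) (hf : IsSmooth f)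
    (hf0 : HasZeroMean f) (hu : IsGlobalLerayHopf ν (fun _ => f) u₀ u)
    (hsup : ∃ C : ℝ, ∀ t : ℝ, 0 ≤ t → kineticEnergy (u t) ≤ C)
    (ha : Continuous a) (ha0 : HasZeroMean a) {K : ℝ} (hK : ∀ x, ‖a x‖ ≤ K) {δ : ℝ} (hδ : 0 < δ) :
    Λ.longTimeAvg (fun t => ∫ x, ⟪a x, u t x⟫) ≤
      δ / 2 + K ^ 2 / (8 * Real.pi ^ 2 * ν * δ) * Λ.longTimeAvg (fun t => ∫ x, ⟪f x, u t x⟫) := by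
  obtain ⟨C, hC⟩ := hsup
  set c₁ : ℝ := K ^ 2 / (8 * Real.pi ^ 2 * ν * δ) with hc₁
  have hc₁0 : 0 ≤ c₁ := by rw [hc₁]; positivity
  set B : ℝ → ℝ := fun t => ∫ x, ⟪a x, u t x⟫ with hBdef
  set P : ℝ → ℝ := fun t => ∫ x, ⟪f x, u t x⟫ with hPdef
  set h : ℝ → ℝ := fun T => δ / 2 + c₁ * (kineticEnergy u₀ * T⁻¹ + timeMean P T) with hhdef
  have hK0 : 0 ≤ K := (norm_nonneg _).trans (hK 0)
  obtain ⟨Kf, hKf0, hKf⟩ := exists_nonneg_forall_norm_le_of_continuous hf.continuous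
  -- the two pairings are bounded on `t > 0`
  have hBbd : ∀ t : ℝ, 0 < t → |B t| ≤ K * (2⁻¹ * (1 + 2 * C)) := by
    intro t ht
    have heq : B t = ∫ x, ⟪u t x, a x⟫ :=
      integral_congr_ae (ae_of_all _ fun x => real_inner_comm _ _)
    rw [heq]
    exact impulseGrid_abs_integral_inner_le hu hK0 hK hC ht.le
  have hPbd : ∀ t : ℝ, 0 < t → |P t| ≤ Kf * (2⁻¹ * (1 + 2 * C)) := by
    intro t ht
    have heq : P t = ∫ x, ⟪u t x, f x⟫ :=
      integral_congr_ae (ae_of_all _ fun x => real_inner_comm _ _)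
    rw [heq]
    exact impulseGrid_abs_integral_inner_le hu hKf0 hKf hC ht.le
  -- `timeMean B` is eventually bounded below, `h` eventually bounded above
  have hg : IsBoundedUnder (· ≥ ·) atTop (timeMean B) := isBoundedUnder_ge_timeMean hBbd
  have hh : IsBoundedUnder (· ≤ ·) atTop h := by
    refine ⟨δ / 2 + c₁ * (kineticEnergy u₀ + Kf * (2⁻¹ * (1 + 2 * C))), ?_⟩
    rw [eventually_map]
    filter_upwards [eventually_ge_atTop (1 : ℝ)] with T hT1
    have hT : 0 < T := by linarith
    have hE0 : 0 ≤ kineticEnergy u₀ := kineticEnergy_nonneg u₀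
    have h1 : kineticEnergy u₀ * T⁻¹ ≤ kineticEnergy u₀ := by
      have hTi : T⁻¹ ≤ 1 := inv_le_one_of_one_le₀ hT1
      calc kineticEnergy u₀ * T⁻¹ ≤ kineticEnergy u₀ * 1 := mul_le_mul_of_nonneg_left hTi hE0
        _ = kineticEnergy u₀ := mul_one _
    have h2 : timeMean P T ≤ Kf * (2⁻¹ * (1 + 2 * C)) :=
      (le_abs_self _).trans (abs_timeMean_le hT fun t ht _ => hPbd t ht)
    have h3 : c₁ * (kineticEnergy u₀ * T⁻¹ + timeMean P T) ≤
        c₁ * (kineticEnergy u₀ + Kf * (2⁻¹ * (1 + 2 * C))) :=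
      mul_le_mul_of_nonneg_left (add_le_add h1 h2) hc₁0
    show h T ≤ _
    simp only [hhdef]
    linarith
  have hle : ∀ᶠ T in atTop, timeMean B T ≤ h T :=
    (eventually_gt_atTop 0).mono fun T hT => timeMean_inner_le hν hf hf0 hu ha ha0 hK hδ hT
  have hmono := Λ.apply_mono hg hh hle
  -- evaluate `Λ h = δ/2 + c₁ Λ(timeMean P)`
  have hdecay : Λ (fun T : ℝ => kineticEnergy u₀ * T⁻¹) = 0 := by
    refine Λ.apply_eq_of_tendsto ?_
    simpa using tendsto_inv_atTop_zero.const_mul (kineticEnergy u₀)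
  have hsplit : h = (fun _ : ℝ => δ / 2) + c₁ • ((fun T : ℝ => kineticEnergy u₀ * T⁻¹) + timeMean P) := by
    funext T
    simp only [hhdef, Pi.add_apply, Pi.smul_apply, smul_eq_mul]
  have hΛh : Λ h = δ / 2 + c₁ * Λ (timeMean P) := by
    rw [hsplit, map_add, map_smul, map_add, Λ.apply_const, hdecay, zero_add, smul_eq_mul]
  unfold GeneralizedLimit.longTimeAvg
  have hfin : Λ (timeMean B) ≤ Λ h := hmono
  rw [hΛh] at hfin
  exact hfin

/-- **The clock-term bound** (two-sided). Along a global Leray–Hopf solution of `NS_ν` (`ν > 0`) on `T³`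
under a steady smooth mean-zero force `f`, with `sup_{t ≥ 0} ½‖u(t)‖₂² < ∞`, for a continuous
mean-zero pattern `a` with `‖a‖ ≤ K`, any generalized limit `Λ` and any `δ > 0`:
`|Λ⟨(a,u)⟩| ≤ δ/2 + K²/(8π²νδ) · Λ⟨(f,u)⟩` — the one-sided bound for `a` and for `−a`. In particular
`ν |Λ⟨(a,u)⟩|` is small whenever `ν` is, uniformly in the energy: `ν|Λ⟨(a,u)⟩| ≤ K √(ν Λ⟨(f,u)⟩)/(2π)`
on optimising `δ` (not needed below). [folklore] -/
theorem abs_longTimeAvg_inner_le (Λ : GeneralizedLimit) (hν : 0 < ν) (hf : IsSmooth f)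
    (hf0 : HasZeroMean f) (hu : IsGlobalLerayHopf ν (fun _ => f) u₀ u)
    (hsup : ∃ C : ℝ, ∀ t : ℝ, 0 ≤ t → kineticEnergy (u t) ≤ C)
    (ha : Continuous a) (ha0 : HasZeroMean a) {K : ℝ} (hK : ∀ x, ‖a x‖ ≤ K) {δ : ℝ} (hδ : 0 < δ) :
    |Λ.longTimeAvg (fun t => ∫ x, ⟪a x, u t x⟫)| ≤
      δ / 2 + K ^ 2 / (8 * Real.pi ^ 2 * ν * δ) * Λ.longTimeAvg (fun t => ∫ x, ⟪f x, u t x⟫) := by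
  have hup := longTimeAvg_inner_le Λ hν hf hf0 hu hsup ha ha0 hK hδ
  have hKn : ∀ x, ‖(-a) x‖ ≤ K := fun x => by
    rw [Pi.neg_apply, norm_neg]
    exact hK x
  have ha0n : HasZeroMean (-a) := by
    unfold HasZeroMean at ha0 ⊢
    simp only [Pi.neg_apply]
    rw [integral_neg, ha0, neg_zero]
  have hlo := longTimeAvg_inner_le Λ hν hf hf0 hu hsup ha.neg ha0n hKn hδ
  have hneg : Λ.longTimeAvg (fun t => ∫ x, ⟪(-a) x, u t x⟫) =
      -Λ.longTimeAvg (fun t => ∫ x, ⟪a x, u t x⟫) := by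
    have h1 : timeMean (fun t => ∫ x, ⟪(-a) x, u t x⟫) =
        -timeMean (fun t => ∫ x, ⟪a x, u t x⟫) := by
      funext T
      simp only [timeMean, Pi.neg_apply, inner_neg_left, integral_neg,
        intervalIntegral.integral_neg, mul_neg]
    unfold GeneralizedLimit.longTimeAvg
    rw [h1, map_neg]
  rw [hneg] at hlo
  exact abs_le.2 ⟨by linarith, hup⟩

end EnergyFreeBridge

/-- **Registered stub `stub_clockTermBound` of line `Sketch` (crux `QuadratureStressFloor`,
stmt-AnomalousDissipation-18129): the energy-free clock-term bound, verbatim registered signature** — for a global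
Leray–Hopf solution of `NS_ν` (`ν > 0`) on `T³` under a steady smooth mean-zero force `f` with a sup-energy bound,
a continuous mean-zero pattern `a` with `‖a‖ ≤ K`, any generalized limit `Λ` and any `δ > 0`:
`|Λ⟨(a,u)⟩| ≤ δ/2 + K²/(8π²νδ) · Λ⟨(f,u)⟩` (`EnergyFreeBridge.abs_longTimeAvg_inner_le`). [folklore] -/
theorem stub_clockTermBound :
    ∀ (Λ : Literature.Analysis.FluidPDE.GeneralizedLimit) (ν δ K : ℝ)
      (f a u₀ : UnitAddTorus (Fin 3) → EuclideanSpace ℝ (Fin 3))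
      (u : ℝ → UnitAddTorus (Fin 3) → EuclideanSpace ℝ (Fin 3)),
      0 < ν → 0 < δ →
      Literature.Analysis.FunctionSpaces.Torus.IsSmooth f →
      Literature.Analysis.FunctionSpaces.Torus.HasZeroMean f →
      Literature.Analysis.FluidPDE.Torus.IsGlobalLerayHopf ν (fun _ => f) u₀ u →
      (∃ C : ℝ, ∀ t : ℝ, 0 ≤ t → Literature.Analysis.FunctionSpaces.Torus.kineticEnergy (u t) ≤ C) →
      Continuous a → Literature.Analysis.FunctionSpaces.Torus.HasZeroMean a → (∀ x, ‖a x‖ ≤ K) →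
      |Λ.longTimeAvg (fun t => ∫ x, inner ℝ (a x) (u t x))| ≤
        δ / 2 + K ^ 2 / (8 * Real.pi ^ 2 * ν * δ) * Λ.longTimeAvg (fun t => ∫ x, inner ℝ (f x) (u t x)) :=
  fun Λ _ν _δ _K _f _a _u₀ _u hν hδ hf hf0 hu hsup ha ha0 hK =>
    EnergyFreeBridge.abs_longTimeAvg_inner_le Λ hν hf hf0 hu hsup ha ha0 hK hδ

end Summit.AnomalousDissipation.AnomalousDissipation.Theorems

end
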